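import Summits.HodgeConjecture.HodgeConjecture.Theorems.F0P6aChartFramePin                           -- ★ re-homed E-defs (D) `AuxChartGS` + the frame pin `IsChartOfFrame`
import Summits.HodgeConjecture.HodgeConjecture.Theorems.F0P6aCMHomKernelShape                        -- ★ KERNEL SHAPE `exists_cmConjHom_kernelShape_frame_of_forall_mem_apply_eq` (LA6 (g0); general `σ ∈ Aut(ℂ∕E)`)
import Literature.AlgebraicGeometry.ShimuraVarieties.UnitaryCurveSpecialPairReciprocityCentralTwistAt   -- ★ p849972 (mine): (S2a) at a GIVEN reflex idèle `exists_siegelRecipDatum_centralTwist_at`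
import Literature.AlgebraicGeometry.ShimuraVarieties.UnitaryCurveSpecialPairOfAuxComplexStructure     -- ★ E2 `isSpecial_auxComplexStructureV_curve` (the `hJsp` clause at `J_{Φ′}`)
import Literature.AlgebraicGeometry.ShimuraVarieties.UnitaryCurveSiegelChartMoverOfClass               -- ★ `UnitaryCurve.exists_mover_of_mk_eq_mk_frame` (the mover of a representative + its reading)
import Literature.AlgebraicGeometry.ShimuraVarieties.UnitaryCurveReciprocityTwistInvariance            -- ★ `shimuraSetGS_mk_twist_eq_of_isArtinCorrespondent'` (two correspondents, one twisted class)
import Literature.AlgebraicGeometry.ModuliOfAbelianVarieties.SiegelCMConjugationHomIntertwines         -- ★ E6-γ core `SiegelAdelicMarking.conjugate_comp_eq_comp_of_adelicCongr₂`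
import Literature.NumberTheory.ComplexMultiplication.CMTypeKottwitzCensusRankTwo                       -- ★ `mem_flip_bar_self : ι₁ ∈ flip ι₁ (bar Φ)`
import Literature.AlgebraicGeometry.AbelianSchemes.AbelianSchemeFibreHom                               -- ★ `AbelianSchemeOver.fibreHom`
import HarnessLib

/-!
# (R-CM) — at a special sheet point, the CM conjugation homomorphism of the σL-CONJUGATE fibre onto ANY principally-marked variety of the TWISTED class
# INTERTWINES the `𝒪_F`-actions ([Milne 2005] Thm. 11.2, Prop. 14.12, Def. 12.8 (62) with the central twist `ũ_V(1, N_{Φ}(s_E))`; [Shimura 1998] §18.6, §21.4)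

Cell `hodgecm-mathlib` (D-0151), FLOOR 0, P6 «MOD programme», crux hLiu418 (stmt-HodgeConjecture-24832, `--supports`, count-neutral), line «L4», closer
`Lines/F0_P6a_StubESHEET.lean`, socket `stub_SHEET`, ROAD (γ′) «Serre tensor over `X`, classified» (A-p01 (g28) 08:39:31Z; LA4-plan (g2) BOOK v3 08:48:23Z),
organ **(R-CM) «`hact` at one special sheet point per connected component»** (LA4-p03 (g3); parts (R-CM-1) CM chain with central twist + (R-CM-2) intertwining
— THIS FILE; part (R-CM-3) «the CM hom is THE tuple iso» is LA6-p02 (g3), consuming this file's `(f, k, hf)`; the pointwise-to-global step (R-RIG) is ★ p850641).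
THEOREMS ONLY (no definition, no instance, no named fact, no `sorry`); ★ lane over the re-homed Theorems defs (a HOME copy over the tree `Lines/` originals
serves the closer).  HONEST LABEL: HC_CM is proved only modulo the 7 printed citations (2 remaining: hLiu418 = stmt-HodgeConjecture-24832, h413 =
stmt-HodgeConjecture-24833) until rung 0 closes; this file is count-neutral.

THE MATHEMATICS — the `σL ∉ Aut(ℂ∕Fᵢ)` TWIN OF Σ-GAL's ★ `F0P6aSigmaGALSockets.kcm_chain_of_cm_recip` + ★ `F0P6aSigmaGAL.exists_fieldPoint_fibre_comp_galA_eq`.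
Chart `C` of `(Fᵢ, τE, Φ)` pinned on the frame `Fr` (twist type `Φ_tw = flip ι₁ (bar Φ)`, reflex compositum `E♯ = ι₁(F)·E*(Φ_tw) ≤ ι₁(F)` for `F∕ℚ` Galois);
`σ ∈ Aut(ℂ)` fixing `ι₁(F)` (so fixing `E♯`) with an `E♯`-correspondent `uE` and torus idèle `z = N_{Φ_tw}(uE)` (the junction's `(γ̃, sE, z)`), an
`F`-correspondent `s` with twist `d` at the special `x₀ = [ι₁w]`; the CM fibre `A := P_x` of the canonical pull-back at the `τE`-sheet point `x` over
`pts⁻¹[ι₁w, a₀]`, with σ1's unit-frame marking `m₁` at `[J(C.Z a v), rep(piece a)]` reading the action `ρ_x` as `C.Mρ a` ([v, a] = [ι₁w, a₀]); and ANY complex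
abelian variety `A₂` of the TWISTED σ-IMAGE class — marked by `m₂` at a PRINCIPAL `r₂` lying, through a rational mover `q′`, over `[C.J v₂, C.b a₂ · ũ_V(1,z)]`
with `[v₂, a₂] = [ι₁w, d·a₀]` — carrying endomorphisms `act₂ b` that read the MOVED frame `q′⁻¹ρ₀(b)q′` through `m₂` (e.g. the Serre tensor `P_{x′} ⊗ 𝔞⁻¹` at the
`τE`-point `x′` over `σ • pts⁻¹[ι₁w,a₀] = pts⁻¹[ι₁w, d·a₀]`, marked by ★ σ1-UNPACK p850665 and put in principal form).  THEN the main theorem of complex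
multiplication at the CM structure of the special point (★ (S2a)-at-an-idèle p849972: `ũ_V(d′, z) = c.cmRecipMatrix Φ′ E♯ uE`, torus law
`ũ_V(d′,z)·ũ_V(a₀,1) = ũ_V(d′a₀,1)·ũ_V(1,z)`, `[ι₁w, d·a₀] = [ι₁w, d′·a₀]`) fed to ★ KERNEL SHAPE gives the CM CONJUGATION HOMOMORPHISM
`f : (P_x)^σ ⟶ A₂` with its `K_δ(N)`-twisted TORSION READING `hf` and the congruence preservation of `(C.Mρ a b, M₂ b)`; ★ E6-γ core then yields
**`(ρ_x b)^σ ≫ f = f ≫ act₂ b`** for every `b ∈ 𝒪_F`.  Since `(P_x)^σ` IS the fibre of `P` at the CONJUGATE-sheet point `ℓ_{τE∘γ}(σ • z₀)` with its action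
(`Spec σ ≫ ℓ_{τE∘γ} = ℓ_{τE} ∘ σ⁻¹`, ★ p850504 §0), this is the CM ANCHOR of (γ′)'s `hact` once (R-CM-3) identifies `f` with LEG-E's tuple iso.
* §1 **`exists_cmConjHom_intertwines_of_centralTwist`** — THE HEAD `(∃ f k, k ∈ K_δ(N) ∧ hf ∧ ∀ b, (ρ_x b)^σ ≫ f = f ≫ act₂ b)`.

## References
* [Milne2005ShimuraVarieties] J. S. Milne, *Introduction to Shimura varieties* (2005; rev. 2017), §11 Thm. 11.2 p. 108, Def. 12.8 (59)–(62) p. 114, §14 Prop. 14.12 p. 125, §5 Lemma 5.13 p. 57.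
* [Shimura1998] G. Shimura, *Abelian Varieties with Complex Multiplication and Modular Functions* (1998), §18.6 pp. 124–128, §21.4 p. 192.
* [Deligne1971TravauxShimura] P. Deligne, *Travaux de Shimura* (1971), 4.18–4.21 pp. 150–152.
* [RapoportSmithlingZhang2020Diagonal] M. Rapoport, B. Smithling, W. Zhang (2020), §3.2 p. 11 (the sheets of `M ⊗_F Fᵢ` and their twists).
-/

set_option autoImplicit false

noncomputable section

namespace Summit.HodgeConjecture.HodgeConjecture.Theorems.F0P6aSpecialFibreConjugationCentralTwist

set_option linter.dupNamespace false  -- `Summit.HodgeConjecture.HodgeConjecture.…` BY DESIGN (D-0017)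

open CategoryTheory CategoryTheory.Limits NumberField IsDedekindDomain MulAction Matrix AlgebraicGeometry
open scoped Matrix ComplexOrder MonObj nonZeroDivisors
open Literature.AlgebraicGeometry.Motives (SchemeOver AlgPoints ComplexPoints specOver CMType AbelianVariety)
open Literature.AlgebraicGeometry.Motives.AbelianVariety (bcSpec)
open Literature.AlgebraicGeometry.AbelianSchemes (PolarizedAbelianSchemeWithLevel AbelianSchemeOver)
open Literature.AlgebraicGeometry.ModuliOfAbelianVarieties
open Literature.AlgebraicGeometry.ShimuraVarieties Literature.AlgebraicGeometry.ShimuraVarieties.UnitaryCanonicalModel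
open Literature.AlgebraicGeometry.ShimuraVarieties.UnitaryCurve Literature.AlgebraicGeometry.ShimuraVarieties.UnitaryCurve.AuxV
open Literature.NumberTheory.Automorphic Literature.NumberTheory.Automorphic.UnitaryGroup
open Literature.NumberTheory.Automorphic.Liu2021.AppendixC (C5.OpenCompactSubgroup C5.SmallLevel)
open Literature.NumberTheory.ComplexMultiplication (reflexNormFiniteIdele traceField)
open Literature.NumberTheory.ComplexMultiplication.CMTypeOps (flip bar mem_flip_bar_self)
open Literature.AlgebraicGeometry.ShimuraVarieties.UnitaryCanonicalModel.Aux (torusFinAdelic reflexField numberField_reflexField ratBasis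
  forall_mem_reflexField_apply_eq_of_isGalois)
open Summit.HodgeConjecture.HodgeConjecture.Cruxes.HLiu418.F0P6aPELWitnessE (GSAdele IsCMTypeThrough mOf AuxChartGS)
open Summit.HodgeConjecture.HodgeConjecture.Cruxes.HLiu418.F0P6aChartFramePin (IsChartOfFrame)
open Summit.HodgeConjecture.HodgeConjecture.Theorems.F0P6aCMHomKernelShape (exists_cmConjHom_kernelShape_frame_of_forall_mem_apply_eq)

variable {F : Type} [Field F] [NumberField F] [IsCMField F] {ι₁ : F →+* ℂ} {Jstar : Matrix (Fin 2) (Fin 2) F}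
  {K₀ : C5.OpenCompactSubgroup (GSAdele F Jstar)} {S : RecordSystemGS F Jstar ι₁ K₀} {Kc : C5.SmallLevel K₀}
  {Fi : Type} [Field Fi] [NumberField Fi] [Algebra F Fi] {τE : Fi →+* ℂ} {Φ : Set (F →+* ℂ)}


/-! ### §0 The TWISTED mover: a representative of `[ι₁w, d′a₀]` with a principal marking over `[C.J v₂, C.b a₂ · u]` -/

set_option maxHeartbeats 400000 in
/-- **THE TWISTED MOVER** (★ `UnitaryCurve.exists_mover_of_mk_eq_mk_frame` with a central factor `u` commuting with `C.b(K)`): if `[v₂, a₂] = [v₀, a₀]` in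
`Sh_{Kc}`, and `q′` moves a principal `r₂` over the TWISTED class `[C.J v₂, C.b a₂ · u]` with the moved frame reading `M₂ = q′⁻¹ρ₀q′`, then
`q₂ := (bq γ)⁻¹ · q′` (for the `γ ∈ GU(ℚ)` with `γ v₀ ∝ v₂`, `γ a₀ Kc = a₂ Kc`) satisfies `q₂_ℝ⁻¹ (C.J v₀) q₂_ℝ = J₂`, `q₂_𝔸 · r₂ K_δ(N) = C.b a₀ · u K_δ(N)` and
`M₂ = q₂⁻¹ρ₀q₂` ((D-lin) `C.bq_comm_ρ₀`). [cite: Milne2005ShimuraVarieties, §5 (5.1) p. 56, Lemma 5.13 p. 57] [cite: Deligne1971TravauxShimura, Déf. 3.13 p. 141] -/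
theorem exists_twistedMover (C : AuxChartGS F ι₁ Jstar K₀ S Kc Fi τE Φ) (u : ↥(gspFinAdelic C.δ))
    (hu : ∀ k' : GSAdele F Jstar, C.b k' * u = u * C.b k')
    {v₂ : Fin 2 → ℂ} (hv₂ : v₂ ∈ negCone (Jstar.map ι₁)) (a₂ : GSAdele F Jstar)
    {v₀ : Fin 2 → ℂ} (hv₀ : v₀ ∈ negCone (Jstar.map ι₁)) (a₀ : GSAdele F Jstar)
    (h : ShimuraSetGS.mk F Jstar ι₁ Kc.1.1 v₂ hv₂ a₂ = ShimuraSetGS.mk F Jstar ι₁ Kc.1.1 v₀ hv₀ a₀)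
    {J₂ : C0pm C.δ} {r₂ : ↥(gspFinAdelic C.δ)} (q' : ↥(gspRational C.δ))
    (hJ₂ : conjJ (((gspRationalToReal C.δ q')⁻¹ : ↥(gspReal C.δ)) : GL (Fin C.g ⊕ Fin C.g) ℝ) (C.J v₂) =
      (J₂ : Matrix (Fin C.g ⊕ Fin C.g) (Fin C.g ⊕ Fin C.g) ℝ))
    (hq' : gspRationalToFinAdelic C.δ q' • ((r₂ : ↥(gspFinAdelic C.δ)) : ↥(gspFinAdelic C.δ) ⧸ principalLevelSubgroup C.δ C.N) =
      ((C.b a₂ * u : ↥(gspFinAdelic C.δ)) : ↥(gspFinAdelic C.δ) ⧸ principalLevelSubgroup C.δ C.N))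
    (M₂ : 𝓞 F → Matrix (Fin C.g ⊕ Fin C.g) (Fin C.g ⊕ Fin C.g) ℤ)
    (hM₂ : ∀ b : 𝓞 F, (M₂ b).map (Int.cast : ℤ → ℚ) =
      (((q'⁻¹ : ↥(gspRational C.δ)) : GL (Fin C.g ⊕ Fin C.g) ℚ) : Matrix (Fin C.g ⊕ Fin C.g) (Fin C.g ⊕ Fin C.g) ℚ) * (C.ρ₀ b).map (Int.cast : ℤ → ℚ) *
        (((q' : ↥(gspRational C.δ)) : GL (Fin C.g ⊕ Fin C.g) ℚ) : Matrix (Fin C.g ⊕ Fin C.g) (Fin C.g ⊕ Fin C.g) ℚ)) :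
    ∃ q₂ : ↥(gspRational C.δ),
      conjJ (((gspRationalToReal C.δ q₂)⁻¹ : ↥(gspReal C.δ)) : GL (Fin C.g ⊕ Fin C.g) ℝ) (C.J v₀) =
          (J₂ : Matrix (Fin C.g ⊕ Fin C.g) (Fin C.g ⊕ Fin C.g) ℝ) ∧
        gspRationalToFinAdelic C.δ q₂ • ((r₂ : ↥(gspFinAdelic C.δ)) : ↥(gspFinAdelic C.δ) ⧸ principalLevelSubgroup C.δ C.N) =
          ((C.b a₀ * u : ↥(gspFinAdelic C.δ)) : ↥(gspFinAdelic C.δ) ⧸ principalLevelSubgroup C.δ C.N) ∧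
        ∀ b : 𝓞 F, (M₂ b).map (Int.cast : ℤ → ℚ) =
          (((q₂⁻¹ : ↥(gspRational C.δ)) : GL (Fin C.g ⊕ Fin C.g) ℚ) : Matrix (Fin C.g ⊕ Fin C.g) (Fin C.g ⊕ Fin C.g) ℚ) * (C.ρ₀ b).map (Int.cast : ℤ → ℚ) *
            (((q₂ : ↥(gspRational C.δ)) : GL (Fin C.g ⊕ Fin C.g) ℚ) : Matrix (Fin C.g ⊕ Fin C.g) (Fin C.g ⊕ Fin C.g) ℚ) := by
  have h0 := (ShimuraSetGS.mk_eq_mk_iff F Jstar ι₁ Kc.1.1 v₂ v₀ hv₂ hv₀ a₂ a₀).1 h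
  obtain ⟨gq, hgq⟩ := h0
  obtain ⟨c, hc, hγv, hγa⟩ := hgq
  -- `C.J v₂ = (bq gq)_ℝ · C.J v₀ · (bq gq)_ℝ⁻¹`
  have hmem : ((ratToGLℂ F Jstar ι₁ gq : GL (Fin 2) ℂ) : Matrix (Fin 2) (Fin 2) ℂ) *ᵥ v₀ ∈ negCone (Jstar.map ι₁) := by
    simpa only [one_smul] using smul_ratToGLℂ_mulVec_mem_negCone F Jstar ι₁ gq one_ne_zero hv₀
  have hJv : C.J v₂ = conjJ ((gspRationalToReal C.δ (C.bq gq) : ↥(gspReal C.δ)) : GL (Fin C.g ⊕ Fin C.g) ℝ) (C.J v₀) := by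
    rw [← hγv, C.hJsmul c hc _ hmem, C.hJrat gq v₀ hv₀]
  -- `a₂ = gq a₀ k′`, `k′ ∈ Kc`, so `C.b a₂ · u = (bq gq)_𝔸 · (C.b a₀ · u) · C.b k′` with `C.b k′ ∈ K_δ(N)` (the central `u` commutes with `C.b k′`)
  have hk : (rationalToFinAdelic (↥(maximalRealSubfield F)) F (IsCMField.complexConj F) 2 Jstar gq * a₀)⁻¹ * a₂ ∈ Kc.1.1 := by
    have h' := hγa
    rw [MulAction.Quotient.smul_coe, smul_eq_mul] at h'
    exact QuotientGroup.eq.1 h'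
  have hba : C.b a₂ * u = gspRationalToFinAdelic C.δ (C.bq gq) * (C.b a₀ * u) *
      C.b ((rationalToFinAdelic (↥(maximalRealSubfield F)) F (IsCMField.complexConj F) 2 Jstar gq * a₀)⁻¹ * a₂) := by
    rw [← C.hb, mul_assoc, mul_assoc, ← hu, ← mul_assoc, ← mul_assoc, ← map_mul, ← map_mul, mul_inv_cancel_left]
  have hbk : C.b ((rationalToFinAdelic (↥(maximalRealSubfield F)) F (IsCMField.complexConj F) 2 Jstar gq * a₀)⁻¹ * a₂) ∈
      principalLevelSubgroup C.δ C.N := C.hle hk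
  refine ⟨(C.bq gq)⁻¹ * q', ?_, ?_, fun b => ?_⟩
  · rw [map_mul, map_inv, _root_.mul_inv_rev, inv_inv, Subgroup.coe_mul, conjJ_mul, ← hJv]
    exact hJ₂
  · rw [map_mul, map_inv, mul_smul, hq', MulAction.Quotient.smul_coe, smul_eq_mul, hba, mul_assoc, inv_mul_cancel_left]
    exact QuotientGroup.mk_mul_of_mem _ hbk
  · have hgqρ : (((C.bq gq : ↥(gspRational C.δ)) : GL (Fin C.g ⊕ Fin C.g) ℚ) : Matrix (Fin C.g ⊕ Fin C.g) (Fin C.g ⊕ Fin C.g) ℚ) *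
          (C.ρ₀ b).map (Int.cast : ℤ → ℚ) *
        ((((C.bq gq)⁻¹ : ↥(gspRational C.δ)) : GL (Fin C.g ⊕ Fin C.g) ℚ) : Matrix (Fin C.g ⊕ Fin C.g) (Fin C.g ⊕ Fin C.g) ℚ) =
        (C.ρ₀ b).map (Int.cast : ℤ → ℚ) := by
      rw [C.bq_comm_ρ₀ gq b, Matrix.mul_assoc, Subgroup.coe_inv, Units.mul_inv, Matrix.mul_one]
    have key : ((((q')⁻¹ : ↥(gspRational C.δ)) : GL (Fin C.g ⊕ Fin C.g) ℚ) : Matrix (Fin C.g ⊕ Fin C.g) (Fin C.g ⊕ Fin C.g) ℚ) *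
          (((C.bq gq : ↥(gspRational C.δ)) : GL (Fin C.g ⊕ Fin C.g) ℚ) : Matrix (Fin C.g ⊕ Fin C.g) (Fin C.g ⊕ Fin C.g) ℚ) *
          (C.ρ₀ b).map (Int.cast : ℤ → ℚ) *
          (((((C.bq gq)⁻¹ : ↥(gspRational C.δ)) : GL (Fin C.g ⊕ Fin C.g) ℚ) : Matrix (Fin C.g ⊕ Fin C.g) (Fin C.g ⊕ Fin C.g) ℚ) *
            (((q' : ↥(gspRational C.δ)) : GL (Fin C.g ⊕ Fin C.g) ℚ) : Matrix (Fin C.g ⊕ Fin C.g) (Fin C.g ⊕ Fin C.g) ℚ)) =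
        ((((q')⁻¹ : ↥(gspRational C.δ)) : GL (Fin C.g ⊕ Fin C.g) ℚ) : Matrix (Fin C.g ⊕ Fin C.g) (Fin C.g ⊕ Fin C.g) ℚ) *
          (C.ρ₀ b).map (Int.cast : ℤ → ℚ) *
          (((q' : ↥(gspRational C.δ)) : GL (Fin C.g ⊕ Fin C.g) ℚ) : Matrix (Fin C.g ⊕ Fin C.g) (Fin C.g ⊕ Fin C.g) ℚ) := by
      rw [show ((((q')⁻¹ : ↥(gspRational C.δ)) : GL (Fin C.g ⊕ Fin C.g) ℚ) : Matrix (Fin C.g ⊕ Fin C.g) (Fin C.g ⊕ Fin C.g) ℚ) *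
            (((C.bq gq : ↥(gspRational C.δ)) : GL (Fin C.g ⊕ Fin C.g) ℚ) : Matrix (Fin C.g ⊕ Fin C.g) (Fin C.g ⊕ Fin C.g) ℚ) *
            (C.ρ₀ b).map (Int.cast : ℤ → ℚ) *
            (((((C.bq gq)⁻¹ : ↥(gspRational C.δ)) : GL (Fin C.g ⊕ Fin C.g) ℚ) : Matrix (Fin C.g ⊕ Fin C.g) (Fin C.g ⊕ Fin C.g) ℚ) *
              (((q' : ↥(gspRational C.δ)) : GL (Fin C.g ⊕ Fin C.g) ℚ) : Matrix (Fin C.g ⊕ Fin C.g) (Fin C.g ⊕ Fin C.g) ℚ)) =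
          ((((q')⁻¹ : ↥(gspRational C.δ)) : GL (Fin C.g ⊕ Fin C.g) ℚ) : Matrix (Fin C.g ⊕ Fin C.g) (Fin C.g ⊕ Fin C.g) ℚ) *
            ((((C.bq gq : ↥(gspRational C.δ)) : GL (Fin C.g ⊕ Fin C.g) ℚ) : Matrix (Fin C.g ⊕ Fin C.g) (Fin C.g ⊕ Fin C.g) ℚ) *
              (C.ρ₀ b).map (Int.cast : ℤ → ℚ) *
              ((((C.bq gq)⁻¹ : ↥(gspRational C.δ)) : GL (Fin C.g ⊕ Fin C.g) ℚ) : Matrix (Fin C.g ⊕ Fin C.g) (Fin C.g ⊕ Fin C.g) ℚ)) *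
            (((q' : ↥(gspRational C.δ)) : GL (Fin C.g ⊕ Fin C.g) ℚ) : Matrix (Fin C.g ⊕ Fin C.g) (Fin C.g ⊕ Fin C.g) ℚ) by
          simp only [Matrix.mul_assoc], hgqρ]
    rw [hM₂ b, _root_.mul_inv_rev, inv_inv, Subgroup.coe_mul, Subgroup.coe_mul, Units.val_mul, Units.val_mul, key]

/-! ### §1 THE HEAD -/

set_option maxHeartbeats 400000 in -- one declaration threading the pin ∕ E2 ∕ (S2a) ∕ two movers ∕ KERNEL SHAPE ∕ E6-γ (as ★ `F0P6aSigmaGAL` §3)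
/-- **(R-CM-1)+(R-CM-2) — THE CM CONJUGATION HOMOMORPHISM WITH CENTRAL TWIST, AND ITS INTERTWINING.**  For `F∕ℚ` Galois, `J⋆` hermitian, a chart `C` of
`(Fᵢ, τE, Φ)` pinned on the frame `Fr`, the canonical pull-back `P` along `ε` with an `𝒪_F`-action `ρ`; `σ ∈ Aut(ℂ)` fixing `ι₁(F)` with an
`E♯`-correspondent `uE` (`E♯ = reflexField F Φ_tw ι₁`, `Φ_tw = flip ι₁ (bar Φ)`) and a torus idèle `z` with `z = N_{Φ_tw}(uE)`; an `F`-correspondent `s` of `σ`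
with twist `d` at the special `[ι₁w]`; the `τE`-sheet point `x` of `X` over `pts⁻¹[ι₁w, a₀]` with σ1's representative `(v, a)`, unit-frame marking `m₁` of the
fibre `P_x` at `[J(C.Z a v), rep(piece a)]` and the RATIONAL reading `hy₁` of `ρ_x` through `m₁` as `C.Mρ a`; and a complex abelian variety `A₂` marked by
`m₂` at a principal `r₂ ∈ K_δ(1)` of complex structure `J₂`, a rational mover `q′` with `q′_ℝ⁻¹ (C.J v₂) q′_ℝ = J₂`, `q′_𝔸 · r₂ K_δ(N) = C.b a₂ · ũ_V(1,z) K_δ(N)`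
for a representative `(v₂, a₂)` of the σ-IMAGE class `[ι₁w, d·a₀]`, and endomorphisms `act₂ b` of `A₂` reading `M₂ b = q′⁻¹ρ₀(b)q′` through `m₂`:
**there are a homomorphism `f : (P_x)^σ ⟶ A₂` and `k ∈ K_δ(N)` with the torsion reading `f((m₁.r v)^σ) = m₂.r w` whenever
`(k·rep(piece a)⁻¹)·v̂ ≡ r₂⁻¹·ŵ`, such that `(ρ_x b)^σ ≫ f = f ≫ act₂ b` for every `b ∈ 𝒪_F`.**
[cite: Milne2005ShimuraVarieties, §11 Thm. 11.2 p. 108, Def. 12.8 (62) p. 114, §14 Prop. 14.12 p. 125] [cite: Shimura1998, §18.6 pp. 124–128, §21.4 p. 192]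
[cite: Deligne1971TravauxShimura, 4.18–4.21 pp. 150–152] [cite: RapoportSmithlingZhang2020Diagonal, §3.2 p. 11] -/
theorem exists_cmConjHom_intertwines_of_centralTwist [IsGalois ℚ F]
    (hJ : (Jstar.map (IsCMField.complexConj F))ᵀ = Jstar) (hΦ : IsCMTypeThrough ι₁ Φ)
    (C : AuxChartGS F ι₁ Jstar K₀ S Kc Fi τE Φ) {ξ : F} {kFr : ℕ} {Fr : SymplecticFrameV F (RingHom.id F) Jstar ((kFr : ℚ) • ξ) C.g C.δ}
    (hpin : IsChartOfFrame hΦ C ξ kFr Fr)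
    (ε : (Literature.AlgebraicGeometry.Motives.baseChange F Fi).obj (S.M.obj Kc) ⟶
        (Literature.AlgebraicGeometry.Motives.baseChange ℚ Fi).obj C.𝓜.M)
    (ρ : AbelianSchemeOver.RingAction (𝓞 F) (C.𝓜.univ.baseChange (ε.left ≫ pullback.fst C.𝓜.M.hom (bcSpec ℚ Fi))).A)
    -- the Galois element, its reflex and `F`-correspondents, the torus idèle, the special datum
    (σ : ℂ ≃ₐ[ℚ] ℂ) (hσF : ∀ y : F, σ (ι₁ y) = ι₁ y)
    (uE : letI := numberField_reflexField F (flip ι₁ (bar (⟨Φ, hΦ.2⟩ : CMType F))) ι₁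
      (FiniteAdeleRing (𝓞 ↥(reflexField F (flip ι₁ (bar (⟨Φ, hΦ.2⟩ : CMType F))) ι₁))
        ↥(reflexField F (flip ι₁ (bar (⟨Φ, hΦ.2⟩ : CMType F))) ι₁))ˣ)
    (hus : letI := numberField_reflexField F (flip ι₁ (bar (⟨Φ, hΦ.2⟩ : CMType F))) ι₁
      IsArtinCorrespondent ↥(reflexField F (flip ι₁ (bar (⟨Φ, hΦ.2⟩ : CMType F))) ι₁)
        (algebraMap ↥(reflexField F (flip ι₁ (bar (⟨Φ, hΦ.2⟩ : CMType F))) ι₁) ℂ) uE σ.toRingEquiv)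
    (z : ↥(torusFinAdelic F))
    (hz : letI := numberField_reflexField F (flip ι₁ (bar (⟨Φ, hΦ.2⟩ : CMType F))) ι₁
      (z : (FiniteAdeleRing (𝓞 F) F)ˣ) = reflexNormFiniteIdele F (flip ι₁ (bar (⟨Φ, hΦ.2⟩ : CMType F)))
        (reflexField F (flip ι₁ (bar (⟨Φ, hΦ.2⟩ : CMType F))) ι₁) uE)
    (s : (FiniteAdeleRing (𝓞 F) F)ˣ) (hs : IsArtinCorrespondent F ι₁ s σ.toRingEquiv)
    (w : Fin 2 → F) (hw : (fun i => ι₁ (w i)) ∈ negCone (Jstar.map ι₁)) (d : GSAdele F Jstar) (hd : IsDiagTwistGS F Jstar w (recipFactor F s) d)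
    (a₀ : GSAdele F Jstar)
    -- the `τE`-sheet point over `pts⁻¹[ι₁w, a₀]` and σ1's datum at it
    (x : letI : Algebra Fi ℂ := τE.toAlgebra; ComplexPoints ((Literature.AlgebraicGeometry.Motives.baseChange F Fi).obj (S.M.obj Kc)))
    (v : Fin 2 → ℂ) (hv : v ∈ negCone (Jstar.map ι₁)) (a : GSAdele F Jstar)
    (hpts : ShimuraSetGS.mk F Jstar ι₁ Kc.1.1 v hv a = ShimuraSetGS.mk F Jstar ι₁ Kc.1.1 (fun i => ι₁ (w i)) hw a₀)
    (m₁ : SiegelAdelicMarking ⟨SiegelModuli.jOfSiegel C.δ (C.Z a v), SiegelComplexRecordSystem.jOfSiegel_mem_C0pm C.hδ.1 (C.Z_mem a v hv)⟩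
      (C.rep (C.piece a)) ((C.𝓜.univ.baseChange (ε.left ≫ pullback.fst C.𝓜.M.hom (bcSpec ℚ Fi))).A.fibre x.left).toAbelianVariety)
    (hy₁ : ∀ (b : 𝓞 F) (w₀ : Fin C.g ⊕ Fin C.g → ℚ),
      haveI := ρ.isMonHom b
      AlgPoints.map (AbelianSchemeOver.fibreHom (ρ.i b) x.left).hom.hom.hom (m₁.r w₀) = m₁.r (((C.Mρ a b).map (Int.cast : ℤ → ℚ)) *ᵥ w₀))
    -- the target: ANY variety of the twisted σ-image class, principally marked through a mover, with a reading action
    {A₂ : AbelianVariety ℂ} (v₂ : Fin 2 → ℂ) (hv₂ : v₂ ∈ negCone (Jstar.map ι₁)) (a₂ : GSAdele F Jstar)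
    (h₂ : ShimuraSetGS.mk F Jstar ι₁ Kc.1.1 v₂ hv₂ a₂ = ShimuraSetGS.mk F Jstar ι₁ Kc.1.1 (fun i => ι₁ (w i)) hw (d * a₀))
    {J₂ : C0pm C.δ} {r₂ : ↥(gspFinAdelic C.δ)} (m₂ : SiegelAdelicMarking J₂ r₂ A₂) (hr₂ : r₂ ∈ principalLevelSubgroup C.δ 1)
    (q' : ↥(gspRational C.δ))
    (hJ₂ : conjJ (((gspRationalToReal C.δ q')⁻¹ : ↥(gspReal C.δ)) : GL (Fin C.g ⊕ Fin C.g) ℝ) (C.J v₂) =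
      (J₂ : Matrix (Fin C.g ⊕ Fin C.g) (Fin C.g ⊕ Fin C.g) ℝ))
    (hq' : gspRationalToFinAdelic C.δ q' • ((r₂ : ↥(gspFinAdelic C.δ)) : ↥(gspFinAdelic C.δ) ⧸ principalLevelSubgroup C.δ C.N) =
      ((C.b a₂ * auxToGspFinV Fr (1, z) : ↥(gspFinAdelic C.δ)) : ↥(gspFinAdelic C.δ) ⧸ principalLevelSubgroup C.δ C.N))
    (M₂ : 𝓞 F → Matrix (Fin C.g ⊕ Fin C.g) (Fin C.g ⊕ Fin C.g) ℤ)
    (hM₂ : ∀ b : 𝓞 F, (M₂ b).map (Int.cast : ℤ → ℚ) =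
      (((q'⁻¹ : ↥(gspRational C.δ)) : GL (Fin C.g ⊕ Fin C.g) ℚ) : Matrix (Fin C.g ⊕ Fin C.g) (Fin C.g ⊕ Fin C.g) ℚ) * (C.ρ₀ b).map (Int.cast : ℤ → ℚ) *
        (((q' : ↥(gspRational C.δ)) : GL (Fin C.g ⊕ Fin C.g) ℚ) : Matrix (Fin C.g ⊕ Fin C.g) (Fin C.g ⊕ Fin C.g) ℚ))
    (act₂ : 𝓞 F → (A₂ ⟶ A₂))
    (hy₂ : ∀ (b : 𝓞 F) (w₀ : Fin C.g ⊕ Fin C.g → ℚ), AlgPoints.map (act₂ b).hom.hom.hom (m₂.r w₀) = m₂.r (((M₂ b).map (Int.cast : ℤ → ℚ)) *ᵥ w₀)) :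
    ∃ (f : (((C.𝓜.univ.baseChange (ε.left ≫ pullback.fst C.𝓜.M.hom (bcSpec ℚ Fi))).A.fibre x.left).toAbelianVariety).conjugate σ.toRingEquiv ⟶ A₂)
      (k : ↥(gspFinAdelic C.δ)),
      k ∈ principalLevelSubgroup C.δ C.N ∧
      (∀ v₀ w₀ : Fin C.g ⊕ Fin C.g → ℚ,
        AdelicCongr ((k * (C.rep (C.piece a))⁻¹ : ↥(gspFinAdelic C.δ)) : GL (Fin C.g ⊕ Fin C.g) finAdeleQ)
            ((r₂⁻¹ : ↥(gspFinAdelic C.δ)) : GL (Fin C.g ⊕ Fin C.g) finAdeleQ) v₀ w₀ →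
          AlgPoints.map f.hom.hom.hom
              ((((C.𝓜.univ.baseChange (ε.left ≫ pullback.fst C.𝓜.M.hom (bcSpec ℚ Fi))).A.fibre x.left).toAbelianVariety).conjPoints σ.toRingEquiv
                (m₁.r v₀)) = m₂.r w₀) ∧
      ∀ b : 𝓞 F,
        haveI := ρ.isMonHom b
        AbelianVariety.Hom.conjugate σ.toRingEquiv (AbelianSchemeOver.fibreHom (ρ.i b) x.left) ≫ f = f ≫ act₂ b := by
  haveI iE : NumberField ↥(reflexField F (flip ι₁ (bar (⟨Φ, hΦ.2⟩ : CMType F))) ι₁) :=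
    numberField_reflexField F (flip ι₁ (bar (⟨Φ, hΦ.2⟩ : CMType F))) ι₁
  letI iFi : Algebra Fi ℂ := τE.toAlgebra
  -- (1) `σ` fixes the reflex compositum `E♯ ≤ ι₁(F)` (`F∕ℚ` Galois)
  have hσE : ∀ y : ℂ, y ∈ reflexField F (flip ι₁ (bar (⟨Φ, hΦ.2⟩ : CMType F))) ι₁ → σ y = y :=
    forall_mem_reflexField_apply_eq_of_isGalois F (flip ι₁ (bar (⟨Φ, hΦ.2⟩ : CMType F))) ι₁ σ hσF
  -- (2) the pin
  have hΦ'm : ι₁ ∈ (flip ι₁ (bar (⟨Φ, hΦ.2⟩ : CMType F))).1 := mem_flip_bar_self (⟨Φ, hΦ.2⟩ : CMType F) hΦ.1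
  obtain ⟨hJe, hbe, -, hρ₀⟩ := hpin
  have hJC' : ∀ v' : Fin 2 → ℂ, v' ∈ negCone (Jstar.map ι₁) →
      auxComplexStructureV Fr ι₁ (flip ι₁ (bar (⟨Φ, hΦ.2⟩ : CMType F))) v' ∈ C0pm C.δ := fun v' hv' => hJe ▸ C.hJ v' hv'
  have hb : ∀ a' : GSAdele F Jstar, C.b a' = auxToGspFinV Fr (a', 1) := fun a' => by
    rw [hbe, MonoidHom.comp_apply, MonoidHom.inl_apply]
  have hu : ∀ k' : GSAdele F Jstar, C.b k' * auxToGspFinV Fr (1, z) = auxToGspFinV Fr (1, z) * C.b k' := fun k' => by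
    rw [hb, ← map_mul, ← map_mul, Prod.mk_mul_mk, Prod.mk_mul_mk, one_mul, mul_one, one_mul, mul_one]
  -- (3) the special-pair clause at `C.J = J_{Φ_tw}` (★ E2, through the pin)
  have hJsp : ∀ (w' : Fin 2 → F) (hw' : (fun i => ι₁ (w' i)) ∈ negCone (Jstar.map ι₁)) (b' : GL (Fin 2) F),
      (fun i => (b' : Matrix (Fin 2) (Fin 2) F) i 1) = w' →
      Literature.AlgebraicGeometry.ShimuraVarieties.hermForm (cmConjRingHom F) Jstar (fun i => (b' : Matrix (Fin 2) (Fin 2) F) i 0) w' = 0 →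
      ∀ c : CMStructure C.g C.δ (Fin 2) (fun _ => F),
        (∀ (y : Fin 2 → F) (p : Fin 2) (m : F),
          c.act y (Fr.β (m • (b' : Matrix (Fin 2) (Fin 2) F) *ᵥ Pi.single p 1)) =
            Fr.β ((y p * m) • (b' : Matrix (Fin 2) (Fin 2) F) *ᵥ Pi.single p 1)) →
        ∀ Φ' : Fin 2 → CMType F, Φ' 0 = flip ι₁ (bar (⟨Φ, hΦ.2⟩ : CMType F)) →
          (∀ ρ' : F →+* ℂ, ρ' ∈ (Φ' 1).1 ↔ (ρ' ∈ (flip ι₁ (bar (⟨Φ, hΦ.2⟩ : CMType F))).1 ∧ ρ' ≠ ι₁) ∨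
            ρ' = NumberField.ComplexEmbedding.conjugate ι₁) →
          c.IsSpecial ⟨C.J (fun i => ι₁ (w' i)), C.hJ _ hw'⟩ Φ' := by
    intro w' hw' b' hb1 hperp c hc Φ' h0 h1
    have hpt : (⟨C.J (fun i => ι₁ (w' i)), C.hJ _ hw'⟩ : ↥(C0pm C.δ)) =
        ⟨auxComplexStructureV Fr ι₁ (flip ι₁ (bar (⟨Φ, hΦ.2⟩ : CMType F))) (fun i => ι₁ (w' i)), hJC' _ hw'⟩ :=
      Subtype.ext (congrFun hJe _)
    rw [hpt]
    exact isSpecial_auxComplexStructureV_curve ι₁ Jstar hJ _ Fr hJC' w' hw' b' hb1 hperp c hc Φ' h0 h1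
  -- (4) (S2a) at the GIVEN reflex idèle `uE` (★ p849972)
  have hS2a := exists_siegelRecipDatum_centralTwist_at ι₁ Jstar hJ (flip ι₁ (bar (⟨Φ, hΦ.2⟩ : CMType F))) hΦ'm Fr C.J C.hJ hJsp
    uE w hw
  obtain ⟨c, hc⟩ := hS2a
  obtain ⟨Φ', hΦ'⟩ := hc
  obtain ⟨t, ht'⟩ := hΦ'
  obtain ⟨d', hd⟩ := ht'
  obtain ⟨hsp, hact, -, -, hE, hrcm, ht, hs'd', hsplit⟩ := hd
  obtain ⟨s', hs'⟩ := hs'd'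
  obtain ⟨hs'all, hd', -⟩ := hs'
  -- (5) the torus idèle of the junction IS (S2a)'s `t`
  have htz : t = z := Subtype.ext (ht.trans hz.symm)
  rw [htz] at hrcm hsplit
  -- (6) the two twists `d` (of `s`) and `d′` (of `s′`) define the same class
  have hww : Literature.AlgebraicGeometry.ShimuraVarieties.hermForm (cmConjRingHom F) Jstar w w ≠ 0 :=
    UnitaryCanonicalModel.hermForm_self_ne_zero_of_embedding_mem_negCone hw
  have hdd' : ShimuraSetGS.mk F Jstar ι₁ Kc.1.1 (fun i => ι₁ (w i)) hw (d * a₀) = ShimuraSetGS.mk F Jstar ι₁ Kc.1.1 (fun i => ι₁ (w i)) hw (d' * a₀) :=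
    shimuraSetGS_mk_twist_eq_of_isArtinCorrespondent' F Jstar hJ ι₁ Kc.1.1 hs (hs'all _ hus) hww hw hd hd' a₀
  -- (7) the mover of σ1's representative `(v, a)` against `(ι₁w, a₀)`, with its reading
  have hmov₁ := exists_mover_of_mk_eq_mk_frame C.J C.hJsmul C.b C.bq C.hb C.hJrat Kc.1.1 C.hle C.piece C.Z C.rep C.q C.q_spec
    (fun b' : 𝓞 F => C.ρ₀ b') (fun a'' (b' : 𝓞 F) => C.Mρ a'' b') C.Mρ_frame C.bq_comm_ρ₀ v hv a (fun i => ι₁ (w i)) hw a₀ hpts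
  obtain ⟨q₁, hq₁'⟩ := hmov₁
  obtain ⟨hJ₁, hq₁, hM₁⟩ := hq₁'
  -- (8) the twisted mover of `(v₂, a₂)` against `(ι₁w, d′a₀)`
  have hmov₂ := exists_twistedMover C (auxToGspFinV Fr (1, z)) hu hv₂ a₂ hw (d' * a₀) (h₂.trans hdd') q' hJ₂ hq' M₂ hM₂
  obtain ⟨q₂, hq₂'⟩ := hmov₂
  obtain ⟨hJ₂', hq₂, hM₂'⟩ := hq₂'
  -- (9) ★ KERNEL SHAPE at `rcm := ũ_V(d′, z)`, `ah := C.b a₀`, `b₂ := C.b (d′a₀) · ũ_V(1, z)`, `t := 1`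
  have hsplit' : auxToGspFinV Fr (d', z) * C.b a₀ = C.b (d' * a₀) * auxToGspFinV Fr (1, z) * 1 := by
    rw [mul_one, hb, hb, hsplit a₀]
  have hρc : ∀ b' : 𝓞 F, ∃ y : Fin 2 → F, (C.ρ₀ b').map (Int.cast : ℤ → ℚ) = c.actMatrix y :=
    fun b' => ⟨fun _ => ((b' : 𝓞 F) : F), (hρ₀ b').trans (hact _).symm⟩
  have hker := exists_cmConjHom_kernelShape_frame_of_forall_mem_apply_eq C.hg C.hδ (Fin 2) (fun _ => F) c
    ⟨C.J (fun i => ι₁ (w i)), C.hJ _ hw⟩ Φ' hsp (reflexField F (flip ι₁ (bar (⟨Φ, hΦ.2⟩ : CMType F))) ι₁) hE σ hσE uE hus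
    (auxToGspFinV Fr (d', z)) hrcm (C.b a₀) (C.b (d' * a₀) * auxToGspFinV Fr (1, z)) 1 m₁ m₂ q₁ q₂ hJ₁ hq₁ hJ₂' hq₂
    (one_mem _) hsplit' hr₂ (fun b' : 𝓞 F => C.ρ₀ b') (fun b' : 𝓞 F => C.Mρ a b') M₂ hρc hM₁ hM₂'
  obtain ⟨f, hf'⟩ := hker
  obtain ⟨k, hk'⟩ := hf'
  obtain ⟨hk, hf, hℓ⟩ := hk'
  -- (10) ★ E6-γ core: the CM hom intertwines
  refine ⟨f, k, hk, hf, fun b => ?_⟩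
  haveI := ρ.isMonHom b
  exact SiegelAdelicMarking.conjugate_comp_eq_comp_of_adelicCongr₂ σ.toRingEquiv m₁ m₂ _ _ f hf _ _ (hℓ b)
    (AbelianSchemeOver.fibreHom (ρ.i b) x.left) (hy₁ b) (act₂ b) (hy₂ b)

end Summit.HodgeConjecture.HodgeConjecture.Theorems.F0P6aSpecialFibreConjugationCentralTwist

end
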